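import Literature.AlgebraicGeometry.ModuliOfAbelianVarieties.SymplecticSimilitudeCoprimeInverse
import Literature.NumberTheory.Automorphic.HeckePairCongruenceSubgroups
import Literature.GroupTheory.ArithmeticGroups.MinkowskiTorsionFree
import Literature.NumberTheory.Adeles.FiniteAdeleLatticeOfGL
import HarnessLib

/-!
# Conjugating `Γ_δ(N·m)` into `Γ_δ(N)` by an `m`-adapted integral similitude, and the Möbius reading

Family `siegel`, layer `Literature/AlgebraicGeometry/ModuliOfAbelianVarieties`, namespace
`Literature.AlgebraicGeometry.ModuliOfAbelianVarieties` (cell hodgecm-mathlib, seat B-p13 (g16); sub-lemma (L3) of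
the Hecke-link brick (A4) «`HeckeLinked` at the lifted point», B-plan1 (g14) 2026-08-29).  THEOREMS ONLY: no
definition, no named fact, no instance, no notation.

## The mathematics

Let `γ ∈ GL_{2g}(ℚ)` be INTEGRAL with `m·γ⁻¹` integral (`m ≥ 1`), and a similitude of the type-`δ` form,
`ᵗγ E_δ γ = ν E_δ` with `ν ≠ 0`.  Shimura's Lemma 3.9 [ShimuraIATAF1971, §3.2] (the tree's
`conj_map_mem_range_of_mem_ker`, with `d = 1`, `d' = m`): for `u ∈ Γ(m)` the conjugate `γ u γ⁻¹` is again in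
`GL_{2g}(ℤ)`; reading the same computation one level deeper, for `u = 1 + N m X ∈ Γ(N·m)` one gets
`γ u γ⁻¹ = 1 + N·(γ X (mγ⁻¹)) ∈ Γ(N)` («`β' γ β ≡ 1 mod (N)`»), and the similitude relation makes the conjugate of a
symplectic matrix symplectic (`ν` cancels).  Hence **`γ Γ_δ(N·m) γ⁻¹ ⊆ Γ_δ(N)`**
(`exists_siegelLevelGroup_map_eq_conj`).  This is the group-theoretic heart of the Hecke correspondence
`𝓐_{g,δ,Nm} → 𝓐_{g,δ,N}` «quotient by an `m`-adapted subgroup» [GenestierNgo2020, §1.3; Milne2005ShimuraVarieties, §5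
p. 58 (the maps `T(g)`) and §6 p. 70 (the Siegel modular variety)].

Möbius reading.  If a real symplectic matrix `P` realises `γ` on Lange's complex structures,
`J(P⁻¹ • Z) = γ_ℝ J(Z) γ_ℝ⁻¹` for all `Z ∈ 𝔥_g` [Lange2023AbelianVarietiesComplex, §7.1.2 Lemma 7.1.7 (pp. 350–353)], then by the
equivariance `J(gD(M) • Z) = M_ℝ J(Z) M_ℝ⁻¹` for `M ∈ Sp_δ(ℤ)` (★ `conjAct_map_intCast_jOfSiegel`) and the injectivity
of `Z ↦ J(Z)` (★ `jOfSiegel_coe_injective`), `γ M' γ⁻¹ = M` reads **`P⁻¹ • (gD(M') • (P • Z)) = gD(M) • Z`**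
(`inv_smul_gDHom_smul_smul_eq`): the move `θ = P⁻¹ • (·)` intertwines the `Γ_δ(N·m)`-orbit of `P • Z` with the
`Γ_δ(N)`-orbit of `Z` (`exists_siegelLevelGroup_inv_smul_gDHom_smul_smul`).  §1 supplies the two integrality
hypotheses from their lattice («`QuotientAdapted`») forms at principal level, where the lattice is `ℤ^{2g}`
(through the tree's entrywise bridges ★ `forall_exists_int_eq_of_forall_mulVec`,
★ `exists_intMatrix_map_eq_of_forall_exists_int_eq` of `SymplecticSimilitudeCoprimeInverse`); §3 also offers the
ENTRYWISE heads matching the `ℓ`-adic producer (`γ`, `m·γ⁻¹` integral entry by entry, `ᵗγ E_δ γ = m E_δ`).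

## References

* [ShimuraIATAF1971] G. Shimura, *Introduction to the Arithmetic Theory of Automorphic Functions* (1971), §3.2
  Lemma 3.9.
* [Lange2023AbelianVarietiesComplex] H. Lange, *Abelian Varieties over the Complex Numbers* (2023), §7.1.2
  Lemma 7.1.6–7.1.7 (pp. 350–353).
* [GenestierNgo2020] A. Genestier, B. C. Ngô, *Lectures on Shimura varieties*, §1.3.
* [Milne2005ShimuraVarieties] J. S. Milne, *Introduction to Shimura varieties* (2005), §4 pp. 48–49, §5 p. 58, §6 p. 70.
-/

noncomputable section

open Matrix
open Literature.NumberTheory.Automorphic (conj_map_mem_range_of_mem_ker exists_eq_one_add_smul_of_mem_ker)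
open Literature.GroupTheory.ArithmeticGroups (mem_ker_map_mk_iff)
open Literature.NumberTheory.Adeles (latticeOfGL mem_latticeOfGL_one_iff)

namespace Literature.AlgebraicGeometry.ModuliOfAbelianVarieties

open SiegelModuli
open Literature.NumberTheory.Automorphic (siegelUpperHalfSpace)

variable {g : ℕ}

/-! ### §1 Integrality of a rational matrix from its action on `ℤⁿ ⊂ ℚⁿ` -/

section Integrality

variable {n : Type*} [Fintype n] [DecidableEq n]

/-- A rational matrix mapping integral vectors to integral vectors is the cast of an integer matrix (the tree's
★ `forall_exists_int_eq_of_forall_mulVec` + ★ `exists_intMatrix_map_eq_of_forall_exists_int_eq`, composed).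
[cite: ShimuraIATAF1971, §3.2 (lattices `L g`)] -/
theorem exists_map_intCastRingHom_eq_of_forall_mulVec {A : Matrix n n ℚ}
    (hA : ∀ v : n → ℚ, (∀ i, ∃ z : ℤ, (z : ℚ) = v i) → ∀ i, ∃ z : ℤ, (z : ℚ) = (A *ᵥ v) i) :
    ∃ G : Matrix n n ℤ, G.map (Int.castRingHom ℚ) = A :=
  exists_intMatrix_map_eq_of_forall_exists_int_eq (forall_exists_int_eq_of_forall_mulVec hA)

/-- The `m`-adapted form: if for every integral `w` there is an integral `v` with `(N·m) • (B w) = N • v` (`N ≠ 0`),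
then `m • B` is the cast of an integer matrix. [cite: ShimuraIATAF1971, §3.2 Lemma 3.9 («`bβ⁻¹ ≺ 𝔬`»)] -/
theorem exists_map_intCastRingHom_eq_smul_of_forall_mulVec {B : Matrix n n ℚ} {N m : ℕ} (hN : N ≠ 0)
    (hB : ∀ w : n → ℚ, (∀ i, ∃ z : ℤ, (z : ℚ) = w i) →
      ∃ v : n → ℚ, (∀ i, ∃ z : ℤ, (z : ℚ) = v i) ∧ ((N * m : ℕ) : ℚ) • B *ᵥ w = (N : ℚ) • v) :
    ∃ G' : Matrix n n ℤ, G'.map (Int.castRingHom ℚ) = (m : ℚ) • B := by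
  refine exists_map_intCastRingHom_eq_of_forall_mulVec fun w hw i => ?_
  obtain ⟨v, hv, hBw⟩ := hB w hw
  have hNq : (N : ℚ) ≠ 0 := Nat.cast_ne_zero.mpr hN
  have h : (m : ℚ) • B *ᵥ w = v := by
    apply smul_right_injective (n → ℚ) hNq
    dsimp only
    rw [smul_smul, ← Nat.cast_mul, hBw]
  rw [Matrix.smul_mulVec, h]
  exact hv i

end Integrality

section LatticeForm

variable {n : Type} [Fintype n] [DecidableEq n]

/-- Lattice form («QA1» at principal level, where `Λ_r = Λ_1 = ℤ^{2g}`): a rational matrix preserving the standard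
lattice `latticeOfGL 1 = ℤⁿ ⊂ ℚⁿ` is the cast of an integer matrix. [cite: ShimuraIATAF1971, §3.2 (lattices `L g`)]
[cite: Milne2005ShimuraVarieties, §4 pp. 48–49] -/
theorem exists_map_intCastRingHom_eq_of_forall_mem_latticeOfGL_one {A : Matrix n n ℚ}
    (hA : ∀ v ∈ latticeOfGL (1 : GL n finAdeleQ), A *ᵥ v ∈ latticeOfGL (1 : GL n finAdeleQ)) :
    ∃ G : Matrix n n ℤ, G.map (Int.castRingHom ℚ) = A :=
  exists_map_intCastRingHom_eq_of_forall_mulVec fun v hv =>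
    mem_latticeOfGL_one_iff.1 (hA v (mem_latticeOfGL_one_iff.2 hv))

/-- Lattice form («QA2» at principal level with `N′ = N·m`): if for every `w ∈ ℤⁿ` there is `v ∈ ℤⁿ` with
`(N·m) • (B w) = N • v` (`N ≠ 0`), then `m • B` is the cast of an integer matrix.
[cite: ShimuraIATAF1971, §3.2 Lemma 3.9 («`bβ⁻¹ ≺ 𝔬`»)] [cite: Milne2005ShimuraVarieties, §4 pp. 48–49] -/
theorem exists_map_intCastRingHom_eq_smul_of_forall_mem_latticeOfGL_one {B : Matrix n n ℚ} {N m : ℕ} (hN : N ≠ 0)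
    (hB : ∀ w ∈ latticeOfGL (1 : GL n finAdeleQ), ∃ v ∈ latticeOfGL (1 : GL n finAdeleQ),
      ((N * m : ℕ) : ℚ) • B *ᵥ w = (N : ℚ) • v) :
    ∃ G' : Matrix n n ℤ, G'.map (Int.castRingHom ℚ) = (m : ℚ) • B := by
  refine exists_map_intCastRingHom_eq_smul_of_forall_mulVec hN fun w hw => ?_
  obtain ⟨v, hv, h⟩ := hB w (mem_latticeOfGL_one_iff.2 hw)
  exact ⟨v, mem_latticeOfGL_one_iff.1 hv, h⟩

end LatticeForm

/-! ### §2 `γ Γ_δ(N·m) γ⁻¹ ⊆ Γ_δ(N)` for an `m`-adapted integral similitude `γ` -/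

section Conjugation

variable {δ : Fin g → ℕ} {N m : ℕ} {γ : GL (Fin g ⊕ Fin g) ℚ} {G G' : Matrix (Fin g ⊕ Fin g) (Fin g ⊕ Fin g) ℤ} {ν : ℚ}

/-- Reduction modulo `n` is the identity iff `n` divides `M - 1` entrywise («`γ ≡ 1_n mod (N)`»; the tree's
`Matrix.forall_dvd_sub_one_iff_map_eq_one`, `Matrix.map` spelling). [cite: ShimuraIATAF1971, §3.2 («γ ≡ 1 mod (N)»)]
[cite: Milne2005ShimuraVarieties, §4 p. 49 (`Γ(N)`)] -/
theorem map_intCastRingHom_zmod_eq_one_iff {k : Type*} [Fintype k] [DecidableEq k] (n : ℕ) (M : Matrix k k ℤ) :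
    M.map (Int.castRingHom (ZMod n)) = 1 ↔ ∀ i j, (n : ℤ) ∣ (M - 1) i j :=
  (Literature.GroupTheory.ArithmeticGroups.Matrix.forall_dvd_sub_one_iff_map_eq_one n M).symm

/-- An element of `Γ_δ(n)` lies in the principal congruence kernel `Γ(a) = ker(GL(ℤ) → GL(ℤ/a))` for every
`a ∣ n`. [cite: ShimuraIATAF1971, §3.2 («γ ≡ 1 mod (N)»)] -/
theorem mem_ker_map_mk_of_mem_siegelLevelGroup {n : ℕ} {a : ℤ} (ha : a ∣ (n : ℤ)) {u : GL (Fin g ⊕ Fin g) ℤ}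
    (hu : u ∈ siegelLevelGroup δ n) :
    u ∈ (Matrix.GeneralLinearGroup.map (n := Fin g ⊕ Fin g) (Ideal.Quotient.mk (Ideal.span {a}))).ker := by
  rw [mem_ker_map_mk_iff]
  have h := (map_intCastRingHom_zmod_eq_one_iff n _).1 (mem_siegelLevelGroup_iff.1 hu).2
  exact fun i j => Ideal.mem_span_singleton.2 (dvd_trans ha (h i j))

/-- **`γ Γ_δ(N·m) γ⁻¹ ⊆ Γ_δ(N)`** for `γ ∈ GL_{2g}(ℚ)` integral with `m·γ⁻¹` integral and `ᵗγ E_δ γ = ν E_δ`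
(`ν ≠ 0`): for every `M' ∈ Γ_δ(N·m)` there is `M ∈ Γ_δ(N)` with `M_ℚ = γ M'_ℚ γ⁻¹`.  Integrality and
invertibility over `ℤ` are Shimura's Lemma 3.9 (`d = 1`, `d' = m`); the level drops from `N·m` to `N` because
`γ (1 + NmX) γ⁻¹ = 1 + N·γX(mγ⁻¹)`; symplecticity because the multiplier `ν` cancels.
[cite: ShimuraIATAF1971, §3.2 Lemma 3.9] [cite: GenestierNgo2020, §1.3] -/
theorem exists_siegelLevelGroup_map_eq_conj (hG : G.map (Int.castRingHom ℚ) = (γ : Matrix (Fin g ⊕ Fin g) (Fin g ⊕ Fin g) ℚ))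
    (hG' : G'.map (Int.castRingHom ℚ) = (m : ℚ) • ((γ⁻¹ : GL (Fin g ⊕ Fin g) ℚ) : Matrix (Fin g ⊕ Fin g) (Fin g ⊕ Fin g) ℚ))
    (hν : ν ≠ 0) (hsim : (γ : Matrix (Fin g ⊕ Fin g) (Fin g ⊕ Fin g) ℚ)ᵀ * typeFormOver δ ℚ * (γ : Matrix (Fin g ⊕ Fin g) (Fin g ⊕ Fin g) ℚ) = ν • typeFormOver δ ℚ)
    (M' : symplecticLatticeGroup δ) (hM' : (M' : GL (Fin g ⊕ Fin g) ℤ) ∈ siegelLevelGroup δ (N * m)) :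
    ∃ M : symplecticLatticeGroup δ, (M : GL (Fin g ⊕ Fin g) ℤ) ∈ siegelLevelGroup δ N ∧
      Matrix.GeneralLinearGroup.map (Int.castRingHom ℚ) (M : GL (Fin g ⊕ Fin g) ℤ) =
        γ * Matrix.GeneralLinearGroup.map (Int.castRingHom ℚ) (M' : GL (Fin g ⊕ Fin g) ℤ) * γ⁻¹ := by
  set φ : ℤ →+* ℚ := Int.castRingHom ℚ with hφ
  have hφi : Function.Injective φ := Int.cast_injective
  have hinj : Function.Injective (fun X : Matrix (Fin g ⊕ Fin g) (Fin g ⊕ Fin g) ℤ => X.map φ) :=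
    Matrix.map_injective hφi
  -- Shimura's Lemma 3.9 with `d = 1`, `d' = m`: the conjugate is an integral unit `W`.
  have hGd : G.map φ = φ 1 • (γ : Matrix (Fin g ⊕ Fin g) (Fin g ⊕ Fin g) ℚ) := by rw [map_one, one_smul]; exact hG
  have hG'd : G'.map φ = φ (m : ℤ) • ((γ⁻¹ : GL (Fin g ⊕ Fin g) ℚ) : Matrix (Fin g ⊕ Fin g) (Fin g ⊕ Fin g) ℚ) := by
    rw [hG', show φ (m : ℤ) = (m : ℚ) from Int.cast_natCast m]
  have hum : (M' : GL (Fin g ⊕ Fin g) ℤ) ∈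
      (Matrix.GeneralLinearGroup.map (n := Fin g ⊕ Fin g) (Ideal.Quotient.mk (Ideal.span {(1 : ℤ) * m}))).ker :=
    mem_ker_map_mk_of_mem_siegelLevelGroup ⟨N, by push_cast; ring⟩ hM'
  obtain ⟨W, hW⟩ := conj_map_mem_range_of_mem_ker φ hφi hGd hG'd hum
  -- matrix form of `hW`
  have coe_map : ∀ u : GL (Fin g ⊕ Fin g) ℤ, ((Matrix.GeneralLinearGroup.map φ u : GL (Fin g ⊕ Fin g) ℚ) :
      Matrix (Fin g ⊕ Fin g) (Fin g ⊕ Fin g) ℚ) = (u : Matrix (Fin g ⊕ Fin g) (Fin g ⊕ Fin g) ℤ).map φ := fun u => rfl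
  have hWm : (W : Matrix (Fin g ⊕ Fin g) (Fin g ⊕ Fin g) ℤ).map φ = (γ : Matrix (Fin g ⊕ Fin g) (Fin g ⊕ Fin g) ℚ) * ((M' : GL (Fin g ⊕ Fin g) ℤ) : Matrix (Fin g ⊕ Fin g) (Fin g ⊕ Fin g) ℤ).map φ *
      ((γ⁻¹ : GL (Fin g ⊕ Fin g) ℚ) : Matrix (Fin g ⊕ Fin g) (Fin g ⊕ Fin g) ℚ) := by
    have h := congrArg (fun u : GL (Fin g ⊕ Fin g) ℚ => (u : Matrix (Fin g ⊕ Fin g) (Fin g ⊕ Fin g) ℚ)) hW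
    simp only [Units.val_mul, coe_map] at h
    exact h
  have hγγ' : (γ : Matrix (Fin g ⊕ Fin g) (Fin g ⊕ Fin g) ℚ) * ((γ⁻¹ : GL (Fin g ⊕ Fin g) ℚ) : Matrix (Fin g ⊕ Fin g) (Fin g ⊕ Fin g) ℚ) = 1 := by
    rw [← Units.val_mul, mul_inv_cancel, Units.val_one]
  have hγ'γ : ((γ⁻¹ : GL (Fin g ⊕ Fin g) ℚ) : Matrix (Fin g ⊕ Fin g) (Fin g ⊕ Fin g) ℚ) * (γ : Matrix (Fin g ⊕ Fin g) (Fin g ⊕ Fin g) ℚ) = 1 := by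
    rw [← Units.val_mul, inv_mul_cancel, Units.val_one]
  -- level: `M' = 1 + (N m) X`, so `W = 1 + N · G X G'`
  have huNm : (M' : GL (Fin g ⊕ Fin g) ℤ) ∈
      (Matrix.GeneralLinearGroup.map (n := Fin g ⊕ Fin g) (Ideal.Quotient.mk (Ideal.span {((N * m : ℕ) : ℤ)}))).ker :=
    mem_ker_map_mk_of_mem_siegelLevelGroup (dvd_refl _) hM'
  obtain ⟨X, hX⟩ := exists_eq_one_add_smul_of_mem_ker huNm
  have hWX : (W : Matrix (Fin g ⊕ Fin g) (Fin g ⊕ Fin g) ℤ) = 1 + (N : ℤ) • (G * X * G') := by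
    apply hinj
    change (W : Matrix (Fin g ⊕ Fin g) (Fin g ⊕ Fin g) ℤ).map φ = ((1 : Matrix (Fin g ⊕ Fin g) (Fin g ⊕ Fin g) ℤ) + (N : ℤ) • (G * X * G')).map φ
    have e1 : ((1 : Matrix (Fin g ⊕ Fin g) (Fin g ⊕ Fin g) ℤ) + ((N * m : ℕ) : ℤ) • X).map φ =
        1 + ((N * m : ℕ) : ℚ) • X.map φ := by
      ext i j
      simp only [Matrix.map_apply, Matrix.add_apply, Matrix.smul_apply, Matrix.one_apply, smul_eq_mul, hφ,
        Int.coe_castRingHom, Int.cast_add, Int.cast_mul, Int.cast_natCast, Int.cast_ite, Int.cast_one, Int.cast_zero]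
    have e2 : ((1 : Matrix (Fin g ⊕ Fin g) (Fin g ⊕ Fin g) ℤ) + (N : ℤ) • (G * X * G')).map φ =
        1 + (N : ℚ) • ((γ : Matrix (Fin g ⊕ Fin g) (Fin g ⊕ Fin g) ℚ) * X.map φ * ((m : ℚ) • ((γ⁻¹ : GL (Fin g ⊕ Fin g) ℚ) : Matrix (Fin g ⊕ Fin g) (Fin g ⊕ Fin g) ℚ))) := by
      rw [← hG, ← hG', ← Matrix.map_mul, ← Matrix.map_mul]
      ext i j
      simp only [Matrix.map_apply, Matrix.add_apply, Matrix.smul_apply, Matrix.one_apply, smul_eq_mul, hφ,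
        Int.coe_castRingHom, Int.cast_add, Int.cast_mul, Int.cast_natCast, Int.cast_ite, Int.cast_one, Int.cast_zero]
    rw [hWm, hX, e1, e2, Matrix.mul_add, Matrix.add_mul, Matrix.mul_one, hγγ', Matrix.mul_smul, Matrix.smul_mul,
      Matrix.mul_smul, smul_smul, Nat.cast_mul, Matrix.mul_assoc]
  have hWlev : (W : Matrix (Fin g ⊕ Fin g) (Fin g ⊕ Fin g) ℤ).map (Int.castRingHom (ZMod N)) = 1 := by
    rw [map_intCastRingHom_zmod_eq_one_iff]
    intro i j
    rw [hWX, add_sub_cancel_left, Matrix.smul_apply, smul_eq_mul]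
    exact dvd_mul_right _ _
  -- symplecticity: `ν` cancels
  have hE : (typeForm δ).map φ = typeFormOver δ ℚ := rfl
  have hU : (((M' : GL (Fin g ⊕ Fin g) ℤ) : Matrix (Fin g ⊕ Fin g) (Fin g ⊕ Fin g) ℤ).map φ)ᵀ * typeFormOver δ ℚ *
      ((M' : GL (Fin g ⊕ Fin g) ℤ) : Matrix (Fin g ⊕ Fin g) (Fin g ⊕ Fin g) ℤ).map φ = typeFormOver δ ℚ := by
    rw [← hE, ← Matrix.transpose_map, ← Matrix.map_mul, ← Matrix.map_mul, mem_symplecticLatticeGroup_iff.1 M'.2]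
  have hB : ((γ⁻¹ : GL (Fin g ⊕ Fin g) ℚ) : Matrix (Fin g ⊕ Fin g) (Fin g ⊕ Fin g) ℚ)ᵀ * typeFormOver δ ℚ *
      ((γ⁻¹ : GL (Fin g ⊕ Fin g) ℚ) : Matrix (Fin g ⊕ Fin g) (Fin g ⊕ Fin g) ℚ) = ν⁻¹ • typeFormOver δ ℚ := by
    rw [eq_inv_smul_iff₀ hν]
    calc ν • (((γ⁻¹ : GL (Fin g ⊕ Fin g) ℚ) : Matrix (Fin g ⊕ Fin g) (Fin g ⊕ Fin g) ℚ)ᵀ * typeFormOver δ ℚ *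
          ((γ⁻¹ : GL (Fin g ⊕ Fin g) ℚ) : Matrix (Fin g ⊕ Fin g) (Fin g ⊕ Fin g) ℚ))
        = ((γ⁻¹ : GL (Fin g ⊕ Fin g) ℚ) : Matrix (Fin g ⊕ Fin g) (Fin g ⊕ Fin g) ℚ)ᵀ *
            ((γ : Matrix (Fin g ⊕ Fin g) (Fin g ⊕ Fin g) ℚ)ᵀ * typeFormOver δ ℚ * (γ : Matrix (Fin g ⊕ Fin g) (Fin g ⊕ Fin g) ℚ)) *
            ((γ⁻¹ : GL (Fin g ⊕ Fin g) ℚ) : Matrix (Fin g ⊕ Fin g) (Fin g ⊕ Fin g) ℚ) := by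
          rw [hsim, Matrix.mul_smul, Matrix.smul_mul]
      _ = ((γ : Matrix (Fin g ⊕ Fin g) (Fin g ⊕ Fin g) ℚ) * ((γ⁻¹ : GL (Fin g ⊕ Fin g) ℚ) : Matrix (Fin g ⊕ Fin g) (Fin g ⊕ Fin g) ℚ))ᵀ * typeFormOver δ ℚ *
            ((γ : Matrix (Fin g ⊕ Fin g) (Fin g ⊕ Fin g) ℚ) * ((γ⁻¹ : GL (Fin g ⊕ Fin g) ℚ) : Matrix (Fin g ⊕ Fin g) (Fin g ⊕ Fin g) ℚ)) := by
          rw [Matrix.transpose_mul]; simp only [Matrix.mul_assoc]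
      _ = typeFormOver δ ℚ := by rw [hγγ', Matrix.transpose_one, Matrix.one_mul, Matrix.mul_one]
  have hWsymp : W ∈ symplecticLatticeGroup δ := by
    rw [mem_symplecticLatticeGroup_iff]
    apply hinj
    change ((W : Matrix (Fin g ⊕ Fin g) (Fin g ⊕ Fin g) ℤ)ᵀ * typeForm δ * (W : Matrix (Fin g ⊕ Fin g) (Fin g ⊕ Fin g) ℤ)).map φ = (typeForm δ).map φ
    rw [Matrix.map_mul, Matrix.map_mul, Matrix.transpose_map, hE, hWm]
    calc ((γ : Matrix (Fin g ⊕ Fin g) (Fin g ⊕ Fin g) ℚ) * ((M' : GL (Fin g ⊕ Fin g) ℤ) : Matrix (Fin g ⊕ Fin g) (Fin g ⊕ Fin g) ℤ).map φ *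
            ((γ⁻¹ : GL (Fin g ⊕ Fin g) ℚ) : Matrix (Fin g ⊕ Fin g) (Fin g ⊕ Fin g) ℚ))ᵀ * typeFormOver δ ℚ *
          ((γ : Matrix (Fin g ⊕ Fin g) (Fin g ⊕ Fin g) ℚ) * ((M' : GL (Fin g ⊕ Fin g) ℤ) : Matrix (Fin g ⊕ Fin g) (Fin g ⊕ Fin g) ℤ).map φ *
            ((γ⁻¹ : GL (Fin g ⊕ Fin g) ℚ) : Matrix (Fin g ⊕ Fin g) (Fin g ⊕ Fin g) ℚ))
        = ((γ⁻¹ : GL (Fin g ⊕ Fin g) ℚ) : Matrix (Fin g ⊕ Fin g) (Fin g ⊕ Fin g) ℚ)ᵀ *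
            ((((M' : GL (Fin g ⊕ Fin g) ℤ) : Matrix (Fin g ⊕ Fin g) (Fin g ⊕ Fin g) ℤ).map φ)ᵀ *
              ((γ : Matrix (Fin g ⊕ Fin g) (Fin g ⊕ Fin g) ℚ)ᵀ * typeFormOver δ ℚ * (γ : Matrix (Fin g ⊕ Fin g) (Fin g ⊕ Fin g) ℚ)) *
              ((M' : GL (Fin g ⊕ Fin g) ℤ) : Matrix (Fin g ⊕ Fin g) (Fin g ⊕ Fin g) ℤ).map φ) *
            ((γ⁻¹ : GL (Fin g ⊕ Fin g) ℚ) : Matrix (Fin g ⊕ Fin g) (Fin g ⊕ Fin g) ℚ) := by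
          rw [Matrix.transpose_mul, Matrix.transpose_mul]; simp only [Matrix.mul_assoc]
      _ = ν • (((γ⁻¹ : GL (Fin g ⊕ Fin g) ℚ) : Matrix (Fin g ⊕ Fin g) (Fin g ⊕ Fin g) ℚ)ᵀ * typeFormOver δ ℚ *
            ((γ⁻¹ : GL (Fin g ⊕ Fin g) ℚ) : Matrix (Fin g ⊕ Fin g) (Fin g ⊕ Fin g) ℚ)) := by
          rw [hsim, Matrix.mul_smul, Matrix.smul_mul, hU, Matrix.mul_smul, Matrix.smul_mul]
      _ = typeFormOver δ ℚ := by rw [hB, smul_smul, mul_inv_cancel₀ hν, one_smul]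
  exact ⟨⟨W, hWsymp⟩, mem_siegelLevelGroup_iff.2 ⟨hWsymp, hWlev⟩, hW⟩

end Conjugation

/-! ### §3 The Möbius reading on `𝔥_g` -/

section Moebius

variable {δ : Fin g → ℕ} {N m : ℕ} {γ : GL (Fin g ⊕ Fin g) ℚ} {G G' : Matrix (Fin g ⊕ Fin g) (Fin g ⊕ Fin g) ℤ} {ν : ℚ}

/-- Lange's equivariance for integral elements, matrix form: `J(gD(M) • Z) = M_ℝ J(Z) M_ℝ⁻¹`
(★ `conjAct_map_intCast_jOfSiegel`). [cite: Lange2023AbelianVarietiesComplex, §7.1.2 Lemma 7.1.6–7.1.7 (pp. 350–353)] -/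
theorem jOfSiegel_gDHom_smul (hδ : ∀ i, 0 < δ i) (M : symplecticLatticeGroup δ) (Z : siegelUpperHalfSpace g) :
    jOfSiegel δ ((gDHom δ hδ M • Z : siegelUpperHalfSpace g) : Matrix (Fin g) (Fin g) ℂ) =
      conjJ (Matrix.GeneralLinearGroup.map (algebraMap ℚ ℝ)
        (Matrix.GeneralLinearGroup.map (Int.castRingHom ℚ) (M : GL (Fin g ⊕ Fin g) ℤ)))
        (jOfSiegel δ (Z : Matrix (Fin g) (Fin g) ℂ)) := by
  have h := congrArg Subtype.val (conjAct_map_intCast_jOfSiegel hδ M Z)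
  rw [coe_conjAct, coe_gspRationalToReal] at h
  exact h.symm

/-- **The Möbius reading of `γ M' γ⁻¹ = M`, `θ`-form (the link's own currency).**  If a self-map `θ` of `𝔥_g`
realises `γ` on complex structures, `J(θ Z) = γ_ℝ J(Z) γ_ℝ⁻¹` for all `Z`, and `M_ℚ = γ M'_ℚ γ⁻¹` for
`M, M' ∈ Sp_δ(ℤ)`, then `θ (gD(M') • W) = gD(M) • θ W` for every `W ∈ 𝔥_g`: both sides have complex structure
`(γM')_ℝ J(W) (γM')_ℝ⁻¹ = (Mγ)_ℝ J(W) (Mγ)_ℝ⁻¹` (equivariance), and `Z ↦ J(Z)` is injective.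
[cite: Lange2023AbelianVarietiesComplex, §7.1.2 Lemma 7.1.6–7.1.7 (pp. 350–353)] -/
theorem apply_gDHom_smul_eq_gDHom_smul_apply (hδ : ∀ i, 0 < δ i) (θ : siegelUpperHalfSpace g → siegelUpperHalfSpace g)
    (hθ : ∀ Z : siegelUpperHalfSpace g, jOfSiegel δ ((θ Z : siegelUpperHalfSpace g) : Matrix (Fin g) (Fin g) ℂ) =
      conjJ (Matrix.GeneralLinearGroup.map (algebraMap ℚ ℝ) γ) (jOfSiegel δ (Z : Matrix (Fin g) (Fin g) ℂ)))
    {M M' : symplecticLatticeGroup δ}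
    (hMM' : Matrix.GeneralLinearGroup.map (Int.castRingHom ℚ) (M : GL (Fin g ⊕ Fin g) ℤ) =
      γ * Matrix.GeneralLinearGroup.map (Int.castRingHom ℚ) (M' : GL (Fin g ⊕ Fin g) ℤ) * γ⁻¹)
    (W : siegelUpperHalfSpace g) :
    θ (gDHom δ hδ M' • W) = gDHom δ hδ M • θ W := by
  have hMγ : Matrix.GeneralLinearGroup.map (Int.castRingHom ℚ) (M : GL (Fin g ⊕ Fin g) ℤ) * γ =
      γ * Matrix.GeneralLinearGroup.map (Int.castRingHom ℚ) (M' : GL (Fin g ⊕ Fin g) ℤ) := by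
    rw [hMM', inv_mul_cancel_right]
  apply jOfSiegel_coe_injective hδ
  rw [hθ, jOfSiegel_gDHom_smul hδ M', ← conjJ_mul, jOfSiegel_gDHom_smul hδ M, hθ, ← conjJ_mul, ← map_mul,
    ← map_mul, hMγ]

/-- **(L3) of the Hecke link, `θ`-form.**  For an `m`-adapted integral similitude `γ` (integral, `m·γ⁻¹`
integral, `ᵗγ E_δ γ = ν E_δ`, `ν ≠ 0`) realised on complex structures by a self-map `θ` of `𝔥_g`
(`J(θ Z) = γ_ℝ J(Z) γ_ℝ⁻¹`), `θ` carries `Γ_δ(N·m)`-orbits into `Γ_δ(N)`-orbits: for every `M' ∈ Γ_δ(N·m)` there is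
`M ∈ Γ_δ(N)` with `θ (gD(M') • W) = gD(M) • θ W` for all `W ∈ 𝔥_g`.
[cite: ShimuraIATAF1971, §3.2 Lemma 3.9] [cite: Lange2023AbelianVarietiesComplex, §7.1.2 Lemma 7.1.6–7.1.7 (pp. 350–353)]
[cite: GenestierNgo2020, §1.3] [cite: Milne2005ShimuraVarieties, §5 p. 58 (the maps T(g)) and §6 p. 70 (the Siegel modular variety)] -/
theorem exists_siegelLevelGroup_apply_gDHom_smul (hδ : ∀ i, 0 < δ i)
    (hG : G.map (Int.castRingHom ℚ) = (γ : Matrix (Fin g ⊕ Fin g) (Fin g ⊕ Fin g) ℚ))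
    (hG' : G'.map (Int.castRingHom ℚ) = (m : ℚ) • ((γ⁻¹ : GL (Fin g ⊕ Fin g) ℚ) : Matrix (Fin g ⊕ Fin g) (Fin g ⊕ Fin g) ℚ))
    (hν : ν ≠ 0) (hsim : (γ : Matrix (Fin g ⊕ Fin g) (Fin g ⊕ Fin g) ℚ)ᵀ * typeFormOver δ ℚ *
      (γ : Matrix (Fin g ⊕ Fin g) (Fin g ⊕ Fin g) ℚ) = ν • typeFormOver δ ℚ)
    (θ : siegelUpperHalfSpace g → siegelUpperHalfSpace g)
    (hθ : ∀ Z : siegelUpperHalfSpace g, jOfSiegel δ ((θ Z : siegelUpperHalfSpace g) : Matrix (Fin g) (Fin g) ℂ) =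
      conjJ (Matrix.GeneralLinearGroup.map (algebraMap ℚ ℝ) γ) (jOfSiegel δ (Z : Matrix (Fin g) (Fin g) ℂ)))
    (M' : symplecticLatticeGroup δ) (hM' : (M' : GL (Fin g ⊕ Fin g) ℤ) ∈ siegelLevelGroup δ (N * m)) :
    ∃ M : symplecticLatticeGroup δ, (M : GL (Fin g ⊕ Fin g) ℤ) ∈ siegelLevelGroup δ N ∧
      ∀ W : siegelUpperHalfSpace g, θ (gDHom δ hδ M' • W) = gDHom δ hδ M • θ W := by
  obtain ⟨M, hM, hMM'⟩ := exists_siegelLevelGroup_map_eq_conj hG hG' hν hsim M' hM'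
  exact ⟨M, hM, apply_gDHom_smul_eq_gDHom_smul_apply hδ θ hθ hMM'⟩

/-- **(L3), entrywise head** (the currency of the `ℓ`-adic producer of the move: `γ` and `m·γ⁻¹` integral ENTRY BY
ENTRY, similitude `ᵗγ E_δ γ = ν E_δ`, `ν ≠ 0`): for every `M' ∈ Γ_δ(N·m)` there is `M ∈ Γ_δ(N)` with
`θ (gD(M') • W) = gD(M) • θ W` for all `W ∈ 𝔥_g`. [cite: ShimuraIATAF1971, §3.2 Lemma 3.9]
[cite: Lange2023AbelianVarietiesComplex, §7.1.2 Lemma 7.1.6–7.1.7 (pp. 350–353)] [cite: GenestierNgo2020, §1.3] -/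
theorem exists_siegelLevelGroup_apply_gDHom_smul_of_entries (hδ : ∀ i, 0 < δ i)
    (hγ : ∀ i j, ∃ z : ℤ, (z : ℚ) = (γ : Matrix (Fin g ⊕ Fin g) (Fin g ⊕ Fin g) ℚ) i j)
    (hγ' : ∀ i j, ∃ z : ℤ, (z : ℚ) =
      (m : ℚ) * ((γ⁻¹ : GL (Fin g ⊕ Fin g) ℚ) : Matrix (Fin g ⊕ Fin g) (Fin g ⊕ Fin g) ℚ) i j)
    (hν : ν ≠ 0) (hsim : (γ : Matrix (Fin g ⊕ Fin g) (Fin g ⊕ Fin g) ℚ)ᵀ * typeFormOver δ ℚ *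
      (γ : Matrix (Fin g ⊕ Fin g) (Fin g ⊕ Fin g) ℚ) = ν • typeFormOver δ ℚ)
    (θ : siegelUpperHalfSpace g → siegelUpperHalfSpace g)
    (hθ : ∀ Z : siegelUpperHalfSpace g, jOfSiegel δ ((θ Z : siegelUpperHalfSpace g) : Matrix (Fin g) (Fin g) ℂ) =
      conjJ (Matrix.GeneralLinearGroup.map (algebraMap ℚ ℝ) γ) (jOfSiegel δ (Z : Matrix (Fin g) (Fin g) ℂ)))
    (M' : symplecticLatticeGroup δ) (hM' : (M' : GL (Fin g ⊕ Fin g) ℤ) ∈ siegelLevelGroup δ (N * m)) :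
    ∃ M : symplecticLatticeGroup δ, (M : GL (Fin g ⊕ Fin g) ℤ) ∈ siegelLevelGroup δ N ∧
      ∀ W : siegelUpperHalfSpace g, θ (gDHom δ hδ M' • W) = gDHom δ hδ M • θ W := by
  obtain ⟨G, hG⟩ := exists_intMatrix_map_eq_of_forall_exists_int_eq hγ
  obtain ⟨G', hG'⟩ := exists_intMatrix_map_eq_of_forall_exists_int_eq
    (A := (m : ℚ) • ((γ⁻¹ : GL (Fin g ⊕ Fin g) ℚ) : Matrix (Fin g ⊕ Fin g) (Fin g ⊕ Fin g) ℚ)) fun i j => by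
      rw [Matrix.smul_apply, smul_eq_mul]; exact hγ' i j
  exact exists_siegelLevelGroup_apply_gDHom_smul hδ hG hG' hν hsim θ hθ M' hM'

/-- **The Möbius reading of `γ M' γ⁻¹ = M`, `P`-form.**  If `P ∈ Sp_{2g}(ℝ)` realises `γ` on complex structures,
`J(P⁻¹ • Z) = γ_ℝ J(Z) γ_ℝ⁻¹` for all `Z`, and `M_ℚ = γ M'_ℚ γ⁻¹` for `M, M' ∈ Sp_δ(ℤ)`, then
`P⁻¹ • (gD(M') • (P • Z)) = gD(M) • Z` for every `Z ∈ 𝔥_g` (equivariance and injectivity of `Z ↦ J(Z)`).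
[cite: Lange2023AbelianVarietiesComplex, §7.1.2 Lemma 7.1.6–7.1.7 (pp. 350–353)] -/
theorem inv_smul_gDHom_smul_smul_eq (hδ : ∀ i, 0 < δ i) (P : Matrix.symplecticGroup (Fin g) ℝ)
    (hP : ∀ Z : siegelUpperHalfSpace g, jOfSiegel δ ((P⁻¹ • Z : siegelUpperHalfSpace g) : Matrix (Fin g) (Fin g) ℂ) =
      conjJ (Matrix.GeneralLinearGroup.map (algebraMap ℚ ℝ) γ) (jOfSiegel δ (Z : Matrix (Fin g) (Fin g) ℂ)))
    {M M' : symplecticLatticeGroup δ}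
    (hMM' : Matrix.GeneralLinearGroup.map (Int.castRingHom ℚ) (M : GL (Fin g ⊕ Fin g) ℤ) =
      γ * Matrix.GeneralLinearGroup.map (Int.castRingHom ℚ) (M' : GL (Fin g ⊕ Fin g) ℤ) * γ⁻¹)
    (Z : siegelUpperHalfSpace g) :
    P⁻¹ • (gDHom δ hδ M' • (P • Z)) = gDHom δ hδ M • Z := by
  have h := apply_gDHom_smul_eq_gDHom_smul_apply hδ (fun W => P⁻¹ • W) hP hMM' (P • Z)
  rwa [inv_smul_smul] at h

/-- **(L3) of the Hecke link.**  For an `m`-adapted integral similitude `γ` (integral, `m·γ⁻¹` integral,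
`ᵗγ E_δ γ = ν E_δ`, `ν ≠ 0`) realised on complex structures by `P ∈ Sp_{2g}(ℝ)` (`J(P⁻¹ • Z) = γ_ℝ J(Z) γ_ℝ⁻¹`),
the move `θ = P⁻¹ • (·)` carries the `Γ_δ(N·m)`-orbit of `P • Z` into the `Γ_δ(N)`-orbit of `Z`: for every
`M' ∈ Γ_δ(N·m)` there is `M ∈ Γ_δ(N)` with `P⁻¹ • (gD(M') • (P • Z)) = gD(M) • Z` for all `Z ∈ 𝔥_g`.
[cite: ShimuraIATAF1971, §3.2 Lemma 3.9] [cite: Lange2023AbelianVarietiesComplex, §7.1.2 Lemma 7.1.6–7.1.7 (pp. 350–353)]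
[cite: GenestierNgo2020, §1.3] -/
theorem exists_siegelLevelGroup_inv_smul_gDHom_smul_smul (hδ : ∀ i, 0 < δ i)
    (hG : G.map (Int.castRingHom ℚ) = (γ : Matrix (Fin g ⊕ Fin g) (Fin g ⊕ Fin g) ℚ))
    (hG' : G'.map (Int.castRingHom ℚ) = (m : ℚ) • ((γ⁻¹ : GL (Fin g ⊕ Fin g) ℚ) : Matrix (Fin g ⊕ Fin g) (Fin g ⊕ Fin g) ℚ))
    (hν : ν ≠ 0) (hsim : (γ : Matrix (Fin g ⊕ Fin g) (Fin g ⊕ Fin g) ℚ)ᵀ * typeFormOver δ ℚ * (γ : Matrix (Fin g ⊕ Fin g) (Fin g ⊕ Fin g) ℚ) = ν • typeFormOver δ ℚ)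
    (P : Matrix.symplecticGroup (Fin g) ℝ)
    (hP : ∀ Z : siegelUpperHalfSpace g, jOfSiegel δ ((P⁻¹ • Z : siegelUpperHalfSpace g) : Matrix (Fin g) (Fin g) ℂ) =
      conjJ (Matrix.GeneralLinearGroup.map (algebraMap ℚ ℝ) γ) (jOfSiegel δ (Z : Matrix (Fin g) (Fin g) ℂ)))
    (M' : symplecticLatticeGroup δ) (hM' : (M' : GL (Fin g ⊕ Fin g) ℤ) ∈ siegelLevelGroup δ (N * m)) :
    ∃ M : symplecticLatticeGroup δ, (M : GL (Fin g ⊕ Fin g) ℤ) ∈ siegelLevelGroup δ N ∧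
      ∀ Z : siegelUpperHalfSpace g, P⁻¹ • (gDHom δ hδ M' • (P • Z)) = gDHom δ hδ M • Z := by
  obtain ⟨M, hM, hMM'⟩ := exists_siegelLevelGroup_map_eq_conj hG hG' hν hsim M' hM'
  exact ⟨M, hM, inv_smul_gDHom_smul_smul_eq hδ P hP hMM'⟩

end Moebius

end Literature.AlgebraicGeometry.ModuliOfAbelianVarieties
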